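import Mathlib.MeasureTheory.Integral.IntervalIntegral.Basic
import HarnessLib

/-!
# Exchanging two normalisations in box statistics (proved)

Trunk T-ANT (`Literature/NumberTheory/LFunctions`). Proofs only: no definitions, no named facts,
nothing about `ζ`. The abstract form of the "exchange of normalisations" in the equivalence
between Montgomery's pair correlation conjecture and the `2`-level GUE hypothesis
(`ZeroStatistics.lean`, `gueHypothesisAt_one_iff_montgomery`): Montgomery measures differences
of ordinates as `(γ − γ') log T / 2π`, Rudnick–Sarnak as `γ̃ − γ̃'` with `γ̃ = γ log γ / 2π`.

`PairCount.tendsto_card_filter_Icc_div_of_close`: let `δ₁ T p`, `δ₂ T p` be two real statistics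
of the members `p ∈ S T` of finite configurations, normalised by `n T > 0`, and let `sm M T p`
single out the "small" members at scale `M`. Assume (i) on non-small members the two statistics
are eventually `ε`-close whenever one of them is bounded (`hclose`), and (ii) the small members
with a bounded statistic are eventually an `ε`-fraction, granted an a-priori bound on the
members with both statistics bounded (`hsmall`). If the closed-box statistics of `δ₁` converge
to `∫_α^β w` (`0 ≤ w ≤ 1` continuous) for all `α < β`, then so do those of `δ₂`.

## References

* H. L. Montgomery, Proc. Sympos. Pure Math. 24 (1973), §1; E. C. Titchmarsh, *The Theory of the
  Riemann Zeta-Function* (1986), §14.34 (the two normalisations).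
* Z. Rudnick, P. Sarnak, Duke Math. J. 81 (1996), §1 Remark 1.
-/

noncomputable section

open Finset MeasureTheory Filter Topology

namespace Literature.NumberTheory.LFunctions

namespace PairCount

/-- **Exchange of normalisations for box statistics.** See the module docstring: closeness of
`δ₁` and `δ₂` off the small members (`hclose`), negligibility of the small members (`hsmall`),
and convergence of the closed-box statistics of `δ₁` to `∫_α^β w` for all `α < β` imply the same
convergence for `δ₂`. (The box `[α, β]` for `δ₂` is squeezed between the boxes `[α ± ε', β ∓ ε']`
for `δ₁` up to the small members; `W(α ∓ ε', β ± ε')` is within `2ε'` of `W(α, β)` since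
`0 ≤ w ≤ 1`.) [folklore] -/
theorem tendsto_card_filter_Icc_div_of_close {κ : Type*} (S : ℝ → Finset κ) (n : ℝ → ℝ)
    (hn : ∀ᶠ T in atTop, 0 < n T) (δ₁ δ₂ : ℝ → κ → ℝ) (sm : ℝ → ℝ → κ → Prop)
    [∀ M T p, Decidable (sm M T p)]
    (hclose : ∀ M : ℝ, 1 ≤ M → ∀ B : ℝ, 0 < B → ∀ ε : ℝ, 0 < ε → ∀ᶠ T in atTop, ∀ p ∈ S T,
      ¬ sm M T p → (|δ₁ T p| ≤ B ∨ |δ₂ T p| ≤ B) → |δ₁ T p - δ₂ T p| ≤ ε)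
    (hsmall : ∀ B : ℝ, 0 < B →
      (∃ C : ℝ, ∀ᶠ T in atTop,
        (((S T).filter fun p ↦ |δ₁ T p| ≤ 2 * B ∧ |δ₂ T p| ≤ 2 * B).card : ℝ) ≤ C * n T) →
      ∀ ε : ℝ, 0 < ε → ∃ M : ℝ, 1 ≤ M ∧ ∀ᶠ T in atTop,
        (((S T).filter fun p ↦ sm M T p ∧ (|δ₁ T p| ≤ B ∨ |δ₂ T p| ≤ B)).card : ℝ) ≤ ε * n T)
    {w : ℝ → ℝ} (hw : Continuous w) (hw0 : ∀ x, 0 ≤ w x) (hw1 : ∀ x, w x ≤ 1)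
    (h₁ : ∀ α β : ℝ, α < β → Tendsto
      (fun T ↦ (((S T).filter fun p ↦ δ₁ T p ∈ Set.Icc α β).card : ℝ) / n T) atTop
        (𝓝 (∫ x in α..β, w x)))
    {α β : ℝ} (hαβ : α < β) :
    Tendsto (fun T ↦ (((S T).filter fun p ↦ δ₂ T p ∈ Set.Icc α β).card : ℝ) / n T) atTop
      (𝓝 (∫ x in α..β, w x)) := by
  classical
  -- integrals of `w`
  have hi : ∀ u v : ℝ, IntervalIntegrable w volume u v := fun u v ↦ hw.intervalIntegrable u v
  have hWle : ∀ u v : ℝ, u ≤ v → ∫ x in u..v, w x ≤ v - u := by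
    intro u v huv
    have := intervalIntegral.integral_mono_on huv (hi u v) intervalIntegrable_const
      (fun x _ ↦ hw1 x)
    simpa using this
  have hW0 : ∀ u v : ℝ, u ≤ v → 0 ≤ ∫ x in u..v, w x := fun u v huv ↦
    intervalIntegral.integral_nonneg huv fun x _ ↦ hw0 x
  have hadd : ∀ u v z : ℝ, (∫ x in u..v, w x) + ∫ x in v..z, w x = ∫ x in u..z, w x :=
    fun u v z ↦ intervalIntegral.integral_add_adjacent_intervals (hi u v) (hi v z)
  -- the a-priori bound at scale `2B`, from the convergence of the `δ₁`-boxes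
  set B : ℝ := max |α| |β| + 1 with hB
  have hB0 : 0 < B := by positivity
  have hIccB : ∀ x ∈ Set.Icc (α - 1) (β + 1), |x| ≤ B := by
    intro x hx
    rw [abs_le]
    constructor
    · have := neg_abs_le α
      linarith [hx.1, le_max_left |α| |β|]
    · have := le_abs_self β
      linarith [hx.2, le_max_right |α| |β|]
  have hapriori : ∃ C : ℝ, ∀ᶠ T in atTop,
      (((S T).filter fun p ↦ |δ₁ T p| ≤ 2 * B ∧ |δ₂ T p| ≤ 2 * B).card : ℝ) ≤ C * n T := by
    refine ⟨(∫ x in (-(2 * B))..(2 * B), w x) + 1, ?_⟩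
    have hlt : -(2 * B) < 2 * B := by linarith
    have hev := (tendsto_order.1 (h₁ _ _ hlt)).2 ((∫ x in (-(2 * B))..(2 * B), w x) + 1)
      (by linarith)
    filter_upwards [hev, hn] with T hT hnT
    rw [div_lt_iff₀ hnT] at hT
    refine le_trans ?_ hT.le
    exact_mod_cast card_le_card fun p hp ↦ by
      simp only [mem_filter, Set.mem_Icc] at hp ⊢
      exact ⟨hp.1, abs_le.1 hp.2.1⟩
  -- `ε`-argument
  rw [Metric.tendsto_nhds]
  intro ε hε
  set ε' : ℝ := min (ε / 8) ((β - α) / 4) with hε'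
  have hε'0 : 0 < ε' := by positivity
  have hε'1 : ε' ≤ ε / 8 := min_le_left _ _
  have hε'2 : ε' ≤ (β - α) / 4 := min_le_right _ _
  obtain ⟨M, hM1, hsm⟩ := hsmall B hB0 hapriori (ε / 4) (by positivity)
  have hcl := hclose M hM1 B hB0 ε' hε'0
  -- the two `δ₁`-boxes
  have hup := h₁ (α - ε') (β + ε') (by linarith)
  have hlow := h₁ (α + ε') (β - ε') (by linarith)
  have hWup : ∫ x in (α - ε')..(β + ε'), w x ≤ (∫ x in α..β, w x) + 2 * ε' := by
    have e1 := hWle (α - ε') α (by linarith)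
    have e2 := hWle β (β + ε') (by linarith)
    have s1 := hadd (α - ε') α (β + ε')
    have s2 := hadd α β (β + ε')
    linarith
  have hWlow : (∫ x in α..β, w x) - 2 * ε' ≤ ∫ x in (α + ε')..(β - ε'), w x := by
    have e1 := hWle α (α + ε') (by linarith)
    have e2 := hWle (β - ε') β (by linarith)
    have s1 := hadd α (α + ε') β
    have s2 := hadd (α + ε') (β - ε') β
    linarith
  have hup' := (tendsto_order.1 hup).2 ((∫ x in α..β, w x) + ε / 2) (by linarith)
  have hlow' := (tendsto_order.1 hlow).1 ((∫ x in α..β, w x) - ε / 2) (by linarith)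
  filter_upwards [hn, hsm, hcl, hup', hlow'] with T hnT hsmT hclT hupT hlowT
  -- notation-free names for the four finsets
  set G := (S T).filter fun p ↦ δ₂ T p ∈ Set.Icc α β with hG
  set U := (S T).filter fun p ↦ δ₁ T p ∈ Set.Icc (α - ε') (β + ε') with hU
  set L := (S T).filter fun p ↦ δ₁ T p ∈ Set.Icc (α + ε') (β - ε') with hL
  set SM := (S T).filter fun p ↦ sm M T p ∧ (|δ₁ T p| ≤ B ∨ |δ₂ T p| ≤ B) with hSM
  -- upper inclusion `G ⊆ U ∪ SM`
  have hGsub : G ⊆ U ∪ SM := by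
    intro p hp
    rw [hG, mem_filter] at hp
    obtain ⟨hpS, hp1, hp2⟩ := hp
    have hδ₂B : |δ₂ T p| ≤ B := hIccB _ ⟨by linarith, by linarith⟩
    rw [mem_union]
    by_cases hs : sm M T p
    · right
      rw [hSM, mem_filter]
      exact ⟨hpS, hs, Or.inr hδ₂B⟩
    · left
      have hc := hclT p hpS hs (Or.inr hδ₂B)
      rw [abs_le] at hc
      rw [hU, mem_filter]
      exact ⟨hpS, by linarith, by linarith⟩
  -- lower inclusion `L ⊆ G ∪ SM`
  have hLsub : L ⊆ G ∪ SM := by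
    intro p hp
    rw [hL, mem_filter] at hp
    obtain ⟨hpS, hp1, hp2⟩ := hp
    have hδ₁B : |δ₁ T p| ≤ B := hIccB _ ⟨by linarith, by linarith⟩
    rw [mem_union]
    by_cases hs : sm M T p
    · right
      rw [hSM, mem_filter]
      exact ⟨hpS, hs, Or.inl hδ₁B⟩
    · left
      have hc := hclT p hpS hs (Or.inl hδ₁B)
      rw [abs_le] at hc
      rw [hG, mem_filter]
      exact ⟨hpS, by linarith, by linarith⟩
  have hGle : (G.card : ℝ) ≤ U.card + SM.card := by
    exact_mod_cast (card_le_card hGsub).trans (card_union_le _ _)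
  have hLle : (L.card : ℝ) ≤ G.card + SM.card := by
    exact_mod_cast (card_le_card hLsub).trans (card_union_le _ _)
  rw [Real.dist_eq, abs_lt]
  rw [lt_div_iff₀ hnT] at hlowT
  rw [div_lt_iff₀ hnT] at hupT
  constructor
  · rw [neg_lt_sub_iff_lt_add, ← sub_lt_iff_lt_add', lt_div_iff₀ hnT]
    nlinarith
  · rw [sub_lt_iff_lt_add', div_lt_iff₀ hnT]
    nlinarith

end PairCount

end Literature.NumberTheory.LFunctions

end
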